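import Summits.BirchSwinnertonDyer.Rank1Residual.Additive.DisegniLineTwistData
import Summits.BirchSwinnertonDyer.Rank1Residual.Additive.SemistableTwistAnalyticOdd
import Literature.NumberTheory.EllipticCurves.PAdicLFunctionMinus
import HarnessLib

/-!
# STEP C⁻(3b) (odd branch, `p ≡ 3 (mod 4)`): the twist data attached to a Heegner field
# (cell `bsd-addord`, seat `bsd-addord-gz` gen 4)

HONEST FRAMING (cell `bsd-addord`; PARTITION (D-0054): EXCLUDED-DOMAIN additive rows §E, B6 = O7-ord r1 ×
every consumer of hFact, rows `p ≡ 3 (mod 4)` — types-the-object-of; booked 0). THEOREMS ONLY. Odd twins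
of `DisegniLineTwistData`: the twist model is `W ≅ V ⊗ χ_{−p}` (`N_E = N_V·p²` via the fundamental
discriminant `−p ≡ 1 (mod 4)`), the coefficient relation is `intCast_LFunction_eq_jacobiChar_mul_cuspCoeff_of_neg`,
and `∑(a/p)[a/p]⁻_{f′} ≠ 0` comes from the ODD Birch formula.

References: [SilvermanAEC2009] X.2 Prop. 2.4, Ex. 10.16; [Cox2013] Lemma 1.14; [MazurTateTeitelbaum1986Invent]
§I.8 (8.6); [Knapp1993] Prop. 12.10.
-/

set_option autoImplicit false

noncomputable section

open scoped Classical MatrixGroups ModularForm NumberField NumberTheorySymbols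

open CongruenceSubgroup WeierstrassCurve NumberField IsDedekindDomain Rat.HeightOneSpectrum
  Literature.NumberTheory.EllipticCurves Literature.NumberTheory.EllipticCurves.ModularForms
  Literature.NumberTheory.EllipticCurves.Rank1Residual Literature.NumberTheory.QuadraticFields
  Literature.NumberTheory.QuadraticFields.Quadratic

namespace Summit.BirchSwinnertonDyer.Rank1Residual.Additive

section TwistOdd

variable {W : WeierstrassCurve ℚ} [W.IsElliptic] [W.IsGloballyMinimal] {p : ℕ} [hp : Fact p.Prime]
  (K : Type) [Field K] [NumberField K]

omit [W.IsElliptic] [W.IsGloballyMinimal] in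
/-- **`N_E = N_V · p²`** for the additive curve `E = W ≅ V ⊗ χ_{−p}` (`p ≡ 3 (mod 4)`, `V` good at `p`):
the conductor of the twist by the fundamental discriminant `−p` prime to `N_V` (tree theorem from
modularity `hmodN`). [cite: DiamondShurman2005, §8.3] -/
theorem conductorNorm_eq_of_good_twist_neg (hmodN : exists_isNewformOf) (hp4 : p % 4 = 3)
    (V : WeierstrassCurve ℚ) [V.IsElliptic] [V.IsGloballyMinimal]
    (hVW : ∃ C : VariableChange ℚ, C • V.quadraticTwist (-(p : ℚ)) = W)
    (hgood : V.HasGoodReductionAtPrime p) : W.conductorNorm ℤ = V.conductorNorm ℤ * p ^ 2 := by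
  have hpP : p.Prime := hp.out
  obtain ⟨C, hC⟩ := hVW
  have hD4 : (-(p : ℤ)) % 4 = 1 := by omega
  have hsq : Squarefree (-(p : ℤ)) := by
    rw [← Int.squarefree_natAbs, Int.natAbs_neg, Int.natAbs_natCast]
    exact hpP.prime.squarefree
  have hgcd : Int.gcd (-(p : ℤ)) (V.conductorNorm ℤ) = 1 := by
    rw [Int.neg_gcd, Int.gcd_natCast_natCast]
    refine (Nat.Prime.coprime_iff_not_dvd hpP).mpr fun h ↦ ?_
    exact (V.dvd_conductorNorm_iff_not_hasGoodReductionAtPrime p).mp h hgood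
  have h := V.conductorNorm_quadraticTwist_of_emod_four_eq_one hmodN hD4 hsq hgcd
  rw [Int.natAbs_neg, Int.natAbs_natCast, Int.cast_neg, Int.cast_natCast] at h
  haveI := V.isElliptic_quadraticTwist (d := -(p : ℚ)) (neg_ne_zero.mpr (by exact_mod_cast hpP.ne_zero))
  rw [← hC, conductorNorm_smul_rat, h]

omit [W.IsGloballyMinimal] in
/-- **The twist data attached to a Heegner field, `p ≡ 3 (mod 4)`.** `E = W` additive, `W ≅ V ⊗ χ_{−p}`
with `V` good ordinary (newform `f`), `K` quadratic with the Heegner hypothesis for `N_E`, `κ` its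
Kronecker character carrying the twist coefficients (`exists_kroneckerChar_twistCoeff`). Then there are a
globally minimal good ordinary `V′ ≅ V ⊗ κ` with newform `f′`, `a_n(f′) = κ(n)·a_n(f)`,
`a_p(V′) = a_p(V)`; moreover `p ∤ d_K` and `a_n(E^{(d_K)}) = κ(n)·a_n(E)`.
[cite: SilvermanAEC2009, X.2 Prop. 2.4 and Exercise 10.16] [cite: Knapp1993, Prop. 12.10]
[cite: Cox2013, §1.C Lemma 1.14] -/
theorem exists_twist_newform_neg (hmodD : nonempty_modularParametrizationData) (hmodN : exists_isNewformOf)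
    (hp4 : p % 4 = 3) (h2 : Module.finrank ℚ K = 2) (κ : DirichletCharacter ℂ (NumberField.discr K).natAbs)
    (hκ : ∀ ℓ : ℕ, ℓ.Prime → ℓ ≠ 2 → κ ℓ = (jacobiSym (NumberField.discr K) ℓ : ℂ))
    (hκall : ∀ (X : WeierstrassCurve ℚ) [X.IsElliptic],
      (∀ v : HeightOneSpectrum (𝓞 ℚ), ((primesEquiv v : ℕ) : ℤ) ∣ NumberField.discr K →
        X.HasGoodReductionAt v) →
      ∀ n : ℕ, (((X.quadraticTwist (NumberField.discr K : ℚ)).LFunction n : ℤ) : ℂ) =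
        κ n * ((X.LFunction n : ℤ) : ℂ))
    (hH : SatisfiesHeegnerHypothesis (W.conductorNorm ℤ) K) (hadd : Addv W p)
    (V : WeierstrassCurve ℚ) [V.IsElliptic] [V.IsGloballyMinimal]
    (hVW : ∃ C : VariableChange ℚ, C • V.quadraticTwist (-(p : ℚ)) = W) (hord : GoodOrd V p)
    {N : ℕ} [NeZero N] {f : CuspForm (Gamma0 N) 2} (hf : IsNewformOf V f) :
    ¬ (p : ℤ) ∣ NumberField.discr K ∧
    (∀ n : ℕ, (((W.quadraticTwist (NumberField.discr K : ℚ)).LFunction n : ℤ) : ℂ) =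
      κ n * ((W.LFunction n : ℤ) : ℂ)) ∧
    ∃ (V' : WeierstrassCurve ℚ) (_ : V'.IsElliptic) (_ : V'.IsGloballyMinimal) (N' : ℕ) (_ : NeZero N')
      (f' : CuspForm (Gamma0 N') 2), IsNewformOf V' f' ∧
      (∀ n : ℕ, cuspCoeff f' n = κ (n : ZMod (NumberField.discr K).natAbs) * cuspCoeff f n) ∧
      V'.frobeniusTrace p = V.frobeniusTrace p ∧ IsOrdinaryAt V' p := by
  have hpP : p.Prime := hp.out
  have hp2 : p ≠ 2 := by omega
  have hd0 : NumberField.discr K ≠ 0 := NumberField.discr_ne_zero K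
  have hdq : (NumberField.discr K : ℚ) ≠ 0 := by exact_mod_cast hd0
  -- `p` splits in `K`
  have hpN : p ∣ W.conductorNorm ℤ :=
    (W.dvd_conductorNorm_iff_not_hasGoodReductionAtPrime p).mpr hadd.1
  obtain ⟨hjp, hpd⟩ := jacobiSym_eq_one_of_heegner K h2 hH hpP hp2 hpN
  have hκp : κ (p : ZMod (NumberField.discr K).natAbs) = 1 := by rw [hκ p hpP hp2, hjp, Int.cast_one]
  -- good reduction of `V` and `W` at the primes of `d_K`
  have hNW : W.conductorNorm ℤ = V.conductorNorm ℤ * p ^ 2 :=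
    conductorNorm_eq_of_good_twist_neg hmodN hp4 V hVW hord.1
  have hHV : SatisfiesHeegnerHypothesis (V.conductorNorm ℤ) K := hH.of_dvd ⟨p ^ 2, hNW⟩
  have hgoodV := hasGoodReductionAt_of_heegner_of_dvd_discr K h2 V hHV
  have hgoodW := hasGoodReductionAt_of_heegner_of_dvd_discr K h2 W hH
  refine ⟨hpd, hκall W hgoodW, ?_⟩
  -- the minimal model of the twist and its newform
  obtain ⟨V', iE, iM, C', hC'⟩ := exists_isGloballyMinimal_smul_eq_quadraticTwist V hdq
  haveI : NeZero (V'.conductorNorm ℤ) := ⟨(V'.conductorNorm_pos_holds).ne'⟩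
  obtain ⟨Dm'⟩ := hmodD V'
  have hLV' : ∀ n : ℕ, V'.LFunction n = (V.quadraticTwist (NumberField.discr K : ℚ)).LFunction n :=
    fun n ↦ by rw [← hC', LFunction_smul]
  have hV' : ∀ n : ℕ, cuspCoeff Dm'.f n = κ (n : ZMod (NumberField.discr K).natAbs) * cuspCoeff f n :=
      fun n ↦ by
    rw [Dm'.isNewformOf.2 n, hf.2 n, hLV' n]
    exact hκall V hgoodV n
  -- `V'` is good ordinary at `p`
  have hordin : IsOrdinaryAt V p := ⟨hord.1, hord.2⟩
  have hordV' : IsOrdinaryAt V' p := by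
    rcases isFundamentalDiscriminant_discr (K := K) h2 with ⟨-, hsq, -⟩ | ⟨h4, -, hsq⟩
    · exact isOrdinaryAt_of_smul_eq_quadraticTwist V V' hsq hC' p hp2 hpd hordin
    · obtain ⟨m, hm⟩ := h4
      have hDm : NumberField.discr K / 4 = m := by rw [hm, Int.mul_ediv_cancel_left _ four_ne_zero]
      rw [hDm] at hsq
      obtain ⟨C₂, hC₂⟩ := V.exists_variableChange_quadraticTwist_mul_sq (m : ℚ) 2 two_ne_zero
      have hdm : ((m : ℚ) * 2 ^ 2) = (NumberField.discr K : ℚ) := by rw [hm]; push_cast; ring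
      rw [hdm] at hC₂
      have hC'' : (C₂⁻¹ * C') • V' = V.quadraticTwist (m : ℚ) := by
        rw [mul_smul, hC', ← hC₂, inv_smul_smul]
      have hpm : ¬ (p : ℤ) ∣ m := fun h ↦ hpd (by rw [hm]; exact h.mul_left 4)
      exact isOrdinaryAt_of_smul_eq_quadraticTwist V V' hsq hC'' p hp2 hpm hordin
  -- `a_p(V′) = a_p(V)`
  have hap : V'.frobeniusTrace p = V.frobeniusTrace p := by
    have e : ((V'.LFunction p : ℤ) : ℂ) = ((V.LFunction p : ℤ) : ℂ) := by
      rw [hLV' p, hκall V hgoodV p, hκp, one_mul]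
    have e' : V'.LFunction p = V.LFunction p := by exact_mod_cast e
    rw [← V'.LFunction_apply_prime_eq_frobeniusTrace p hordV'.1,
      ← V.LFunction_apply_prime_eq_frobeniusTrace p hord.1, e']
  exact ⟨V', iE, iM, V'.conductorNorm ℤ, inferInstance, Dm'.f, Dm'.isNewformOf, hV', hap, hordV'⟩

omit [W.IsGloballyMinimal] in
/-- **`∑(a/p)[a/p]⁻_{f′} ≠ 0` from `L(E^{(d_K)}, 1) ≠ 0`, `p ≡ 3 (mod 4)`.** The coefficients of
`E^{(d_K)}` are `κ(n)·(n/p)·a_n(f) = (n/p)·a_n(f′)`, so `L(E^{(d_K)}, s)` continues `L(f′, χ_p, s)` and the ODD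
Birch formula `∑(a/p)[a/p]⁻_{f′}·Ω⁻_{f′}·i = τ(χ_p)·L(f′, χ_p, 1)` (tree theorem) makes the sum non-zero.
[cite: MazurTateTeitelbaum1986Invent, §I.8 (8.6)] [cite: SilvermanAEC2009, C.16] -/
theorem legendreMinusSymbolSum_ne_zero_of_twist (hmod : hasEntireLFunction_rat) (hp4 : p % 4 = 3)
    (κ : DirichletCharacter ℂ (NumberField.discr K).natAbs)
    (hκW : ∀ n : ℕ, (((W.quadraticTwist (NumberField.discr K : ℚ)).LFunction n : ℤ) : ℂ) =
      κ n * ((W.LFunction n : ℤ) : ℂ))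
    (hadd : Addv W p) (V : WeierstrassCurve ℚ) [V.IsElliptic] [V.IsGloballyMinimal]
    (hVW : ∃ C : VariableChange ℚ, C • V.quadraticTwist (-(p : ℚ)) = W)
    {N N' : ℕ} [NeZero N] [NeZero N'] {f : CuspForm (Gamma0 N) 2} {f' : CuspForm (Gamma0 N') 2}
    (hf : IsNewformOf V f) (hf' : IsNewform0 f') (hQ' : coeffField f' = ⊥)
    (hV' : ∀ n : ℕ, cuspCoeff f' n = κ (n : ZMod (NumberField.discr K).natAbs) * cuspCoeff f n)
    (hLd : (W.quadraticTwist (NumberField.discr K : ℚ)).entireLFunction 1 ≠ 0) :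
    legendreMinusSymbolSum f' p ≠ 0 := by
  haveI : NeZero p := ⟨hp.out.ne_zero⟩
  have hpP : p.Prime := hp.out
  have hp2 : p ≠ 2 := by omega
  have hdq : (NumberField.discr K : ℚ) ≠ 0 := by exact_mod_cast NumberField.discr_ne_zero K
  haveI := W.isElliptic_quadraticTwist hdq
  set Wd := W.quadraticTwist (NumberField.discr K : ℚ) with hWd
  have hEnt : Wd.HasEntireLFunction := hmod Wd
  obtain ⟨hχ1, hχq, hχprim⟩ := jacobiChar_prime_ne_one_isQuadratic_isPrimitive p hp2
  have hχo := jacobiChar_odd_of_mod_four_eq_three p hp4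
  set χ := jacobiChar p with hχdef
  -- the coefficients of `E^{(d_K)}` are those of `f' ⊗ χ_p`
  have hco : ∀ n : ℕ, ((Wd.LFunction n : ℤ) : ℂ) = χ n * cuspCoeff f' n := by
    intro n
    rw [hWd, hκW n, hV' n, intCast_LFunction_eq_jacobiChar_mul_cuspCoeff_of_neg p hp4 V W hVW hadd hf n]
    ring
  obtain ⟨L₂, hL₂d, hL₂⟩ := exists_differentiable_eq_twistedLSeries_holds f' χ
  -- identity theorem: `L(E^{(d_K)}, s) = L₂(s)`
  have heq : Wd.entireLFunction = L₂ := by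
    refine AnalyticOnNhd.eq_of_eventuallyEq (z₀ := (3 : ℂ))
      ((Wd.differentiable_entireLFunction hEnt).differentiableOn.analyticOnNhd isOpen_univ)
      (hL₂d.differentiableOn.analyticOnNhd isOpen_univ) ?_
    have hopen : IsOpen {s : ℂ | (2 : ℝ) < s.re} := isOpen_lt continuous_const Complex.continuous_re
    filter_upwards [hopen.mem_nhds (show (2 : ℝ) < (3 : ℂ).re by norm_num)] with s hs
    have hs' : (2 : ℝ) < s.re := hs
    rw [Wd.entireLFunction_eq_LSeries hEnt (by linarith), LSeries_eq_twistedLSeries_of_coeff Wd f' χ hco,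
      hL₂ s hs']
  have hL₂1 : L₂ 1 ≠ 0 := by rw [← heq]; exact hLd
  -- odd Birch's formula for `f'` at `χ_p`
  have hBirch := ratMinusTwistedSymbolSum_mul_minusPeriod_mul_I f' hf' hQ' hχprim hχo hL₂d
    (fun s hs ↦ by rw [hχq.inv]; exact hL₂ s hs)
  rw [← cast_legendreMinusSymbolSum_eq_ratMinusTwistedSymbolSum p f'] at hBirch
  have hτ : gaussSum χ (ZMod.stdAddChar (N := p)) ≠ 0 := by
    intro h
    have hsq := gaussSum_sq hχ1 hχq (ZMod.isPrimitive_stdAddChar p)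
    rw [h, hχo, ZMod.card, zero_pow two_ne_zero] at hsq
    have : (p : ℂ) = 0 := by linear_combination hsq
    exact (Nat.cast_ne_zero.mpr hpP.ne_zero) this
  intro hS
  rw [hS, Rat.cast_zero, zero_mul, zero_mul] at hBirch
  exact mul_ne_zero hτ hL₂1 hBirch.symm

end TwistOdd

end Summit.BirchSwinnertonDyer.Rank1Residual.Additive

end
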